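import Summits.CriticalPhenomena.SAWScalingLimit.Theorems.SAWTotalPositivityCriticalBubbleBoundJoinMoments

/-!
# Density form of a block decay: exceedances of the pointwise power law are sparse
(crux `SAWTotalPositivity.CriticalBubbleBound`, stmt-CriticalPhenomena-7117; line `docking-census-joining`,
registered stub `sparse_exceed_of_blockDecay` of the join-mass programme, lead prover c6)

Hammond's theorem is stated on a FULL-DENSITY set of lengths (`p_n μ^{-n} ≤ n^{-3/2+o(1)}` for a
density-one set of even `n`); the join-mass bootstrap delivers DYADIC-BLOCK bounds
`Σ_{n ∈ B_i} t n ≤ C_s 2^{s i}` for every `s > s₀`. This file is the (Markov) bridge between the two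
shapes: under such a block decay, for every `0 < ε ≤ 1` the number of `n < 2^I` at which
`t n > (n+1)^{s₀ - 1 + ε}` is `O(2^{(1 - ε/2) I})` — a vanishing proportion. It also transfers the
block decay of the shifted class sequence `jterm` to the class sequence `cterm` itself.
[cite: Hammond2015SAPJoining, Theorem 1.3]
-/

noncomputable section

open Literature.Probability.LatticeModels
open Literature.Probability.RandomPlanarGeometry Literature.Probability.RandomPlanarGeometry.SAW
open scoped BigOperators
open Summit.CriticalPhenomena.SAWScalingLimit.Theorems.CriticalBubbleBound.Negative (e₀)
open Summit.CriticalPhenomena.SAWScalingLimit.Theorems.CriticalBubbleBound.Docking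

namespace Summit.CriticalPhenomena.SAWScalingLimit.Theorems.CriticalBubbleBound.Join

/-- Markov's inequality on a dyadic block: the number of `n ∈ B_i` with `a < t n` is at most
`blockMass t i / a`. [folklore] -/
theorem card_filter_lt_le_blockMass_div {t : ℕ → ℝ} (ht : ∀ n, 0 ≤ t n) {a : ℝ} (ha : 0 < a)
    (i : ℕ) : ((((block i).filter fun n => a < t n).card : ℕ) : ℝ) ≤ blockMass t i / a := by
  classical
  rw [le_div_iff₀ ha]
  calc ((((block i).filter fun n => a < t n).card : ℕ) : ℝ) * a
        = ∑ _n ∈ (block i).filter (fun n => a < t n), a := by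
          rw [Finset.sum_const, nsmul_eq_mul]
    _ ≤ ∑ n ∈ (block i).filter (fun n => a < t n), t n :=
          Finset.sum_le_sum fun n hn => (Finset.mem_filter.1 hn).2.le
    _ ≤ ∑ n ∈ block i, t n :=
          Finset.sum_le_sum_of_subset_of_nonneg (Finset.filter_subset _ _) fun n _ _ => ht n
    _ = blockMass t i := rfl

/-- On the dyadic block `B_i`, `(n+1)^u ≥ 2^{-|u|} · 2^{u i}` (both signs of `u`). [folklore] -/
theorem rpow_succ_ge_on_block {i n : ℕ} (hn : n ∈ block i) (u : ℝ) :
    (2 : ℝ) ^ (-|u|) * (2 : ℝ) ^ (u * (i : ℝ)) ≤ ((n : ℝ) + 1) ^ u := by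
  have h := rpow_succ_le_on_block hn (-u)
  rw [abs_neg] at h
  have hn0 : (0 : ℝ) < (n : ℝ) + 1 := by positivity
  have e1 : ((n : ℝ) + 1) ^ u = (((n : ℝ) + 1) ^ (-u))⁻¹ := by
    rw [Real.rpow_neg hn0.le, inv_inv]
  have e2 : (2 : ℝ) ^ (-|u|) * (2 : ℝ) ^ (u * (i : ℝ)) =
      ((2 : ℝ) ^ |u| * (2 : ℝ) ^ (-u * (i : ℝ)))⁻¹ := by
    rw [mul_inv, Real.rpow_neg (by norm_num : (0 : ℝ) ≤ 2), neg_mul,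
      Real.rpow_neg (by norm_num : (0 : ℝ) ≤ 2), inv_inv]
  rw [e1, e2]
  exact inv_anti₀ (Real.rpow_pos_of_pos hn0 _) h

/-- Every `n < 2^I` other than `0` lies in a block `B_i` with `i < I`. [folklore] -/
theorem exists_mem_block_of_lt {n I : ℕ} (hn : n ≠ 0) (hI : n < 2 ^ I) :
    ∃ i, i < I ∧ n ∈ block i := by
  refine ⟨Nat.log 2 n, ?_, mem_block_log hn⟩
  have h1 : 2 ^ Nat.log 2 n ≤ n := Nat.pow_log_le_self 2 hn
  exact (Nat.pow_lt_pow_iff_right (by norm_num : 1 < 2)).1 (lt_of_le_of_lt h1 hI)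

/-- **Density form of a block decay** (registered stub `sparse_exceed_of_blockDecay`): if
`Σ_{n ∈ B_i} t n ≤ C_s 2^{s i}` for every `s > s₀`, then for every `0 < ε ≤ 1` the exceedance set
`{n < 2^I : t n > (n+1)^{s₀ - 1 + ε}}` has at most `C 2^{(1 - ε/2) I}` elements — a proportion
`O(2^{-ε I/2})` of the lengths below `2^I`. [cite: Hammond2015SAPJoining, Theorem 1.3] -/
theorem sparse_exceed_of_blockDecay : ∀ (t : ℕ → ℝ) (s₀ : ℝ), (∀ n, 0 ≤ t n) →
    (∀ s : ℝ, s₀ < s → ∃ C : ℝ, ∀ i : ℕ, blockMass t i ≤ C * (2 : ℝ) ^ (s * (i : ℝ))) →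
    ∀ ε : ℝ, 0 < ε → ε ≤ 1 → ∃ C : ℝ, ∀ I : ℕ,
      ((((Finset.range (2 ^ I)).filter fun n : ℕ => ((n : ℝ) + 1) ^ (s₀ - 1 + ε) < t n).card : ℕ) : ℝ)
        ≤ C * (2 : ℝ) ^ ((1 - ε / 2) * (I : ℝ)) := by
  intro t s₀ ht hdecay ε hε hε1
  classical
  obtain ⟨C, hC⟩ := hdecay (s₀ + ε / 2) (by linarith)
  have hC0 : 0 ≤ C := by
    have h0 := hC 0
    simp only [Nat.cast_zero, mul_zero, Real.rpow_zero, mul_one] at h0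
    exact le_trans (blockMass_nonneg ht 0) h0
  set u : ℝ := s₀ - 1 + ε with hu
  -- the ratio `r = 2^{1 - ε/2} > 1`
  set r : ℝ := (2 : ℝ) ^ (1 - ε / 2) with hr
  have hr1 : 1 < r := Real.one_lt_rpow (by norm_num) (by linarith)
  have hr0 : 0 < r := lt_trans one_pos hr1
  have hrpow : ∀ k : ℕ, (2 : ℝ) ^ ((1 - ε / 2) * (k : ℝ)) = r ^ k := fun k => by
    rw [hr, ← Real.rpow_natCast, ← Real.rpow_mul (by norm_num : (0 : ℝ) ≤ 2)]
  -- per-block count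
  have hblock : ∀ i : ℕ,
      ((((block i).filter fun n : ℕ => ((n : ℝ) + 1) ^ u < t n).card : ℕ) : ℝ) ≤ C * (2 : ℝ) ^ |u| * r ^ i := by
    intro i
    set a : ℝ := (2 : ℝ) ^ (-|u|) * (2 : ℝ) ^ (u * (i : ℝ)) with ha_def
    have ha : 0 < a := by rw [ha_def]; positivity
    have hsub : ((block i).filter fun n : ℕ => ((n : ℝ) + 1) ^ u < t n) ⊆
        ((block i).filter fun n => a < t n) := by
      intro n hn
      rw [Finset.mem_filter] at hn ⊢
      exact ⟨hn.1, lt_of_le_of_lt (rpow_succ_ge_on_block hn.1 u) hn.2⟩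
    calc ((((block i).filter fun n : ℕ => ((n : ℝ) + 1) ^ u < t n).card : ℕ) : ℝ)
          ≤ ((((block i).filter fun n => a < t n).card : ℕ) : ℝ) := by
            exact_mod_cast Finset.card_le_card hsub
      _ ≤ blockMass t i / a := card_filter_lt_le_blockMass_div ht ha i
      _ ≤ C * (2 : ℝ) ^ ((s₀ + ε / 2) * (i : ℝ)) / a := div_le_div_of_nonneg_right (hC i) ha.le
      _ = C * (2 : ℝ) ^ |u| * r ^ i := by
          rw [div_eq_iff ha.ne', ha_def, ← hrpow i]
          have e : (2 : ℝ) ^ ((s₀ + ε / 2) * (i : ℝ)) =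
              (2 : ℝ) ^ ((1 - ε / 2) * (i : ℝ)) * (2 : ℝ) ^ (u * (i : ℝ)) := by
            rw [← Real.rpow_add (by norm_num : (0 : ℝ) < 2)]; congr 1; rw [hu]; ring
          have e' : (2 : ℝ) ^ |u| * (2 : ℝ) ^ (-|u|) = 1 := by
            rw [← Real.rpow_add (by norm_num : (0 : ℝ) < 2), add_neg_cancel, Real.rpow_zero]
          rw [e]
          calc C * ((2 : ℝ) ^ ((1 - ε / 2) * (i : ℝ)) * (2 : ℝ) ^ (u * (i : ℝ)))
                = C * 1 * ((2 : ℝ) ^ ((1 - ε / 2) * (i : ℝ)) * (2 : ℝ) ^ (u * (i : ℝ))) := by rw [mul_one]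
            _ = C * ((2 : ℝ) ^ |u| * (2 : ℝ) ^ (-|u|)) *
                  ((2 : ℝ) ^ ((1 - ε / 2) * (i : ℝ)) * (2 : ℝ) ^ (u * (i : ℝ))) := by rw [e']
            _ = C * (2 : ℝ) ^ |u| * (2 : ℝ) ^ ((1 - ε / 2) * (i : ℝ)) *
                  ((2 : ℝ) ^ (-|u|) * (2 : ℝ) ^ (u * (i : ℝ))) := by ring
  -- summing the blocks below `2^I`
  set K : ℝ := C * (2 : ℝ) ^ |u| with hK
  have hK0 : 0 ≤ K := by rw [hK]; positivity
  refine ⟨1 + K / (r - 1), fun I => ?_⟩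
  have hcover : ((Finset.range (2 ^ I)).filter fun n : ℕ => ((n : ℝ) + 1) ^ u < t n) ⊆
      insert 0 ((Finset.range I).biUnion fun i => (block i).filter fun n : ℕ => ((n : ℝ) + 1) ^ u < t n) := by
    intro n hn
    rw [Finset.mem_filter, Finset.mem_range] at hn
    rw [Finset.mem_insert, Finset.mem_biUnion]
    rcases eq_or_ne n 0 with h0 | h0
    · exact Or.inl h0
    · obtain ⟨i, hi, hmem⟩ := exists_mem_block_of_lt h0 hn.1
      exact Or.inr ⟨i, Finset.mem_range.2 hi, Finset.mem_filter.2 ⟨hmem, hn.2⟩⟩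
  have hgeom : ∑ i ∈ Finset.range I, r ^ i ≤ r ^ I / (r - 1) := by
    rw [geom_sum_eq hr1.ne', div_le_div_iff_of_pos_right (sub_pos.2 hr1)]
    linarith [pow_pos hr0 I]
  have hrI : 1 ≤ r ^ I := one_le_pow₀ hr1.le
  have hnat : ((Finset.range (2 ^ I)).filter fun n : ℕ => ((n : ℝ) + 1) ^ u < t n).card ≤
      1 + ∑ i ∈ Finset.range I, ((block i).filter fun n : ℕ => ((n : ℝ) + 1) ^ u < t n).card := by
    have h0 := Finset.card_le_card hcover
    have h1 := Finset.card_insert_le 0 ((Finset.range I).biUnion fun i =>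
      (block i).filter fun n : ℕ => ((n : ℝ) + 1) ^ u < t n)
    have h2 := Finset.card_biUnion_le (s := Finset.range I)
      (t := fun i => (block i).filter fun n : ℕ => ((n : ℝ) + 1) ^ u < t n)
    omega
  have hreal : ((((Finset.range (2 ^ I)).filter fun n : ℕ => ((n : ℝ) + 1) ^ u < t n).card : ℕ) : ℝ) ≤
      1 + ∑ i ∈ Finset.range I,
          ((((block i).filter fun n : ℕ => ((n : ℝ) + 1) ^ u < t n).card : ℕ) : ℝ) := by
    exact_mod_cast hnat
  calc ((((Finset.range (2 ^ I)).filter fun n : ℕ => ((n : ℝ) + 1) ^ u < t n).card : ℕ) : ℝ)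
        ≤ 1 + ∑ i ∈ Finset.range I,
          ((((block i).filter fun n : ℕ => ((n : ℝ) + 1) ^ u < t n).card : ℕ) : ℝ) := hreal
    _ ≤ 1 + ∑ i ∈ Finset.range I, K * r ^ i := by
          gcongr with i hi
          rw [hK]
          exact hblock i
    _ = 1 + K * ∑ i ∈ Finset.range I, r ^ i := by rw [Finset.mul_sum]
    _ ≤ 1 + K * (r ^ I / (r - 1)) := by gcongr
    _ ≤ (1 + K / (r - 1)) * r ^ I := by
          rw [add_mul, one_mul, div_mul_eq_mul_div, mul_div_assoc]
          linarith
    _ = (1 + K / (r - 1)) * (2 : ℝ) ^ ((1 - ε / 2) * (I : ℝ)) := by rw [hrpow I]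

/-- Block decay passes from the shifted class sequence `jterm` to the class sequence `cterm`
(`Σ_{B_i} cterm ≤ R'_i + R'_{i+1}` for `i ≥ 4`, the first four blocks go into the constant).
[folklore] -/
theorem blockDecay_cterm_of_jterm
    (hdecay : ∀ s : ℝ, -(1 : ℝ) / 2 < s → ∃ C : ℝ, ∀ i : ℕ, blockMass jterm i ≤ C * (2 : ℝ) ^ (s * (i : ℝ))) :
    ∀ s : ℝ, -(1 : ℝ) / 2 < s → ∃ C : ℝ, ∀ i : ℕ, blockMass cterm i ≤ C * (2 : ℝ) ^ (s * (i : ℝ)) := by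
  intro s hs
  obtain ⟨C, hC⟩ := hdecay s hs
  have hC0 : 0 ≤ C := by
    have h0 := hC 0
    simp only [Nat.cast_zero, mul_zero, Real.rpow_zero, mul_one] at h0
    exact le_trans (blockMass_nonneg jterm_nonneg 0) h0
  set K : ℝ := C * (1 + (2 : ℝ) ^ s) with hK
  have hK0 : 0 ≤ K := by rw [hK]; positivity
  set K' : ℝ := K + ∑ j ∈ Finset.range 4, blockMass cterm j * (2 : ℝ) ^ (-(s * (j : ℝ))) with hK'
  have hterm0 : ∀ j, 0 ≤ blockMass cterm j * (2 : ℝ) ^ (-(s * (j : ℝ))) := fun j =>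
    mul_nonneg (blockMass_nonneg cterm_nonneg j) (Real.rpow_nonneg (by norm_num) _)
  refine ⟨K', fun i => ?_⟩
  have hpow : 0 < (2 : ℝ) ^ (s * (i : ℝ)) := Real.rpow_pos_of_pos (by norm_num) _
  rcases le_or_gt 4 i with hi | hi
  · have e1 : (2 : ℝ) ^ (s * ((i + 1 : ℕ) : ℝ)) = (2 : ℝ) ^ (s * (i : ℝ)) * (2 : ℝ) ^ s := by
      rw [← Real.rpow_add (by norm_num : (0 : ℝ) < 2)]; congr 1; push_cast; ring
    calc blockMass cterm i = ∑ n ∈ block i, cterm n := rfl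
      _ ≤ blockMass jterm i + blockMass jterm (i + 1) := sum_block_cterm_le hi
      _ ≤ C * (2 : ℝ) ^ (s * (i : ℝ)) + C * (2 : ℝ) ^ (s * ((i + 1 : ℕ) : ℝ)) :=
          add_le_add (hC i) (hC (i + 1))
      _ = K * (2 : ℝ) ^ (s * (i : ℝ)) := by rw [e1, hK]; ring
      _ ≤ K' * (2 : ℝ) ^ (s * (i : ℝ)) := by
          apply mul_le_mul_of_nonneg_right _ hpow.le
          rw [hK']
          linarith [Finset.sum_nonneg fun j (_ : j ∈ Finset.range 4) => hterm0 j]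
  · have hmem : i ∈ Finset.range 4 := Finset.mem_range.2 hi
    have hle : blockMass cterm i * (2 : ℝ) ^ (-(s * (i : ℝ))) ≤ K' := by
      rw [hK']
      have := Finset.single_le_sum (fun j _ => hterm0 j) hmem
      linarith
    have hone : (2 : ℝ) ^ (-(s * (i : ℝ))) * (2 : ℝ) ^ (s * (i : ℝ)) = 1 := by
      rw [← Real.rpow_add (by norm_num : (0 : ℝ) < 2), neg_add_cancel, Real.rpow_zero]
    calc blockMass cterm i
          = blockMass cterm i * ((2 : ℝ) ^ (-(s * (i : ℝ))) * (2 : ℝ) ^ (s * (i : ℝ))) := by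
            rw [hone, mul_one]
      _ = blockMass cterm i * (2 : ℝ) ^ (-(s * (i : ℝ))) * (2 : ℝ) ^ (s * (i : ℝ)) := by ring
      _ ≤ K' * (2 : ℝ) ^ (s * (i : ℝ)) := mul_le_mul_of_nonneg_right hle hpow.le

end Summit.CriticalPhenomena.SAWScalingLimit.Theorems.CriticalBubbleBound.Join

end
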